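import Summits.BirchSwinnertonDyer.BirchSwinnertonDyer.Theses.AdditiveKolyvaginRoad
import Summits.BirchSwinnertonDyer.BirchSwinnertonDyer.Theorems.AdditiveKolyvaginRoadLevelSystemsOfBipartite
import HarnessLib

/-!
# Route `AdditiveKolyvaginRoad`, crux `LevelKolyvaginSystemsAdditive` (item stmt-BirchSwinnertonDyer-21396, KS′):
# THE BIPARTITE DICTIONARY, part 3 — the crux BY NAME from ONE displayed bipartite hypothesis
# (cell `pub/bsd-wall`, width seat `bsd-wall-akr-p2x-w2` g0 on line `birth`; `--supports stmt-BirchSwinnertonDyer-21396`, helper;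
# parts 1–2 = `AdditiveKolyvaginRoadLevelSystemsEvenLevels`, `AdditiveKolyvaginRoadLevelSystemsOfBipartite`)

WHAT. `levelKolyvaginSystemsAdditive_of_bipartite`: the route's crux `LevelKolyvaginSystemsAdditive` (KS′ — W. Zhang's LEVEL
KOLYVAGIN SYSTEMS at every ♯ additive frame, `Nonempty (LevelKolyvaginSystemP W K p Dt β ι c)`) FOLLOWS from ONE hypothesis
displayed in full: at every ♯ additive frame (the crux's own binders, VERBATIM) and complex conjugation `c ≠ 1`, there are signs
`ε₀`, classes `κ₀(m, n) ∈ H¹(K, E[p])` owed at the EVEN levels (realisation at `∅` by the frame's Kolyvagin classes; sign ∕ Kummer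
off the support ∕ toric on the level ∕ transverse on the conductor ∕ (8.1) at even non-empty levels), values `λ(m, n) ∈ 𝔽_p` at the
ODD levels, the two ONE-DIRECTIONAL Bertolini–Darmon reciprocity halves (A⇐) «`λ(m, n∪q) ≠ 0 ⟹ κ₀(m, n)` not locally trivial
above `q`» and (B⇒) «`κ₀(m, n'∪q)` not locally trivial above `q ⟹ λ(m, n') ≠ 0`», and the rank-0 ANCHOR (γ) at the odd levels
«`dim Sel_{n'}⁺ + dim Sel_{n'}⁻ = 0 ⟹ λ(∅, n') ≠ 0`». Proof = part 2's `nonempty_levelKolyvaginSystemP_of_bipartite_at_frame`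
((A1) rank lowering discharged there by the landed `stub_rankLoweringAdditive`).

READING. This is the KERNEL FORM of the route's T5 ceiling statement for KS′: the crux is EXACTLY «a mod-`p` bipartite Euler
system for `(E, K, p)` at the additive prime extending E's Kolyvagin classes (type-preserving level raising, Jacquet–Langlands ∕
Ihara and BD reciprocity at `p²`-level) + the rank-0 anchor at the DEFINITE levels», both unprinted at `p² ∣ N` (crux dossier
DEAD-LINES D2/D3) and NEITHER asserted here — the hypothesis is a binder, not a fact.

HONEST FRAMING: one theorem; 0 definitions, 0 named facts, 0 `sorry`; CONDITIONAL on its displayed hypothesis; closes nothing.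
BSD is not proved by any of this.

References: [cite: WZhang2014, §3, Thm. 4.3, Prop. 5.4, Thm. 7.1, Thm. 7.2, §8.1, §9] [cite: BertoliniDarmon2005, Thm. 4.1,
Thm. 4.2].
-/

-- single-conjunct summit: `Summit.BirchSwinnertonDyer.BirchSwinnertonDyer.…` repeats the name by design
set_option linter.dupNamespace false

noncomputable section

open scoped Classical

namespace Summit.BirchSwinnertonDyer.BirchSwinnertonDyer.Theorems.AdditiveKoly

open WeierstrassCurve NumberField IsDedekindDomain
  Literature.NumberTheory.EllipticCurves Literature.NumberTheory.EllipticCurves.ModularForms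
  Literature.NumberTheory.EllipticCurves.Rank1Residual Literature.NumberTheory.GaloisRepresentations Module
  Summit.BirchSwinnertonDyer.BirchSwinnertonDyer.Theses.AdditiveKolyvaginRoad

/-- **KS′ BY NAME FROM ONE BIPARTITE HYPOTHESIS.** If at every ♯ additive frame of the route (`p ≥ 5`, `Addv W p`, `ρ̄_{E,p}` onto,
♠(1) ∕ ♠(2), `p ∤ ∏ c_ℓ`, `r_an = 1`, `K` imaginary quadratic, `d_K` odd, `d_K < −4`, Heegner hypothesis, `L(E^{d_K}, 1) ≠ 0`,
`4N ∣ β² − d_K`, `p ∤ c_Manin`) and every complex conjugation `c ≠ 1` there is a BIPARTITE DATUM — signs `ε₀`, even-level classes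
`κ₀` with the realisation identity and the local Kolyvagin-system axioms at even non-empty levels, odd-level values `λ`, the
reciprocity halves (A⇐) ∕ (B⇒), and the rank-0 anchor (γ) at odd levels — then the crux `LevelKolyvaginSystemsAdditive` holds.
[cite: WZhang2014, §3, Thm. 4.3, Thm. 7.2, §9] [cite: BertoliniDarmon2005, Thm. 4.1, Thm. 4.2] -/
theorem levelKolyvaginSystemsAdditive_of_bipartite
    (H : ∀ (W : WeierstrassCurve ℚ) [W.IsElliptic] [W.IsGloballyMinimal] [NeZero (W.conductorNorm ℤ)]
      (p : ℕ) [Fact p.Prime] (K : Type) [Field K] [NumberField K]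
      (Dt : ModularParametrizationData W (W.conductorNorm ℤ)) (β : ℤ) (ι : K →+* ℂ),
      5 ≤ p → Addv W p → W.HasSurjectiveModNGaloisRep p →
      (∀ (ℓ : ℕ) [Fact ℓ.Prime], W.HasMultiplicativeReductionAtPrime ℓ →
        ¬ p ∣ padicValInt ℓ W.minimalDiscriminantInt) →
      (∃ (ℓ₁ ℓ₂ : ℕ) (_ : Fact ℓ₁.Prime) (_ : Fact ℓ₂.Prime), ℓ₁ ≠ ℓ₂ ∧
        W.HasMultiplicativeReductionAtPrime ℓ₁ ∧ W.HasMultiplicativeReductionAtPrime ℓ₂) →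
      ¬ p ∣ W.tamagawaProduct → W.analyticRank = 1 →
      IsImaginaryQuadratic K → Odd (NumberField.discr K) → NumberField.discr K < -4 →
      SatisfiesHeegnerHypothesis (W.conductorNorm ℤ) K →
      (W.quadraticTwist (NumberField.discr K : ℚ)).entireLFunction 1 ≠ 0 →
      (4 * (W.conductorNorm ℤ : ℤ)) ∣ β ^ 2 - NumberField.discr K → ¬ (p : ℤ) ∣ Dt.c →
      ∀ (c : K ≃ₐ[ℚ] K), c ≠ 1 → ∀ [Module (ZMod p) (Vp W K p)],
      ∃ (ε₀ : Finset (AdmQ W K p) → Bool)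
        (κ₀ : Finset {ℓ // Zhang2014.IsKolyvaginPrime (W.conductorNorm ℤ) W K p ℓ} → Finset (AdmQ W K p) → Vp W K p)
        (lam : Finset {ℓ // Zhang2014.IsKolyvaginPrime (W.conductorNorm ℤ) W K p ℓ} → Finset (AdmQ W K p) → ZMod p),
        -- realisation at level `∅`
        (∀ m : Finset {ℓ // Zhang2014.IsKolyvaginPrime (W.conductorNorm ℤ) W K p ℓ},
          ∃ d : KolyvaginHeegnerData Dt β ι (∏ ℓ ∈ m, (ℓ : ℕ)), κ₀ m ∅ = d.kolyvaginClass (Fact.out : p.Prime) 1) ∧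
        -- sign
        (∀ n : Finset (AdmQ W K p), n.Nonempty → Even n.card →
          ∀ m : Finset {ℓ // Zhang2014.IsKolyvaginPrime (W.conductorNorm ℤ) W K p ℓ},
          conjAct W c ((p ^ 1 : ℕ) : ℤ) (κ₀ m n) = sgnP (ε₀ n ^^ Nat.bodd m.card) • κ₀ m n) ∧
        -- selmer_off
        (∀ n : Finset (AdmQ W K p), n.Nonempty → Even n.card →
          ∀ (m : Finset {ℓ // Zhang2014.IsKolyvaginPrime (W.conductorNorm ℤ) W K p ℓ}) (v : HeightOneSpectrum (𝓞 K)),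
          (∀ ℓ ∈ m, ((ℓ : ℕ) : 𝓞 K) ∉ v.asIdeal) → (∀ q ∈ n, ((q : ℕ) : 𝓞 K) ∉ v.asIdeal) →
          κ₀ m n ∈ selmerLocalKer (W.baseChange K) (v.adicCompletion K) ((p ^ 1 : ℕ) : ℤ)) ∧
        -- selmer_inf
        (∀ n : Finset (AdmQ W K p), n.Nonempty → Even n.card →
          ∀ (m : Finset {ℓ // Zhang2014.IsKolyvaginPrime (W.conductorNorm ℤ) W K p ℓ}) (w : InfinitePlace K),
          κ₀ m n ∈ selmerLocalKer (W.baseChange K) w.Completion ((p ^ 1 : ℕ) : ℤ)) ∧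
        -- toric_on
        (∀ n : Finset (AdmQ W K p), n.Nonempty → Even n.card →
          ∀ m : Finset {ℓ // Zhang2014.IsKolyvaginPrime (W.conductorNorm ℤ) W K p ℓ}, ∀ q ∈ n,
          ∀ v : HeightOneSpectrum (𝓞 K), ((q : ℕ) : 𝓞 K) ∈ v.asIdeal →
          κ₀ m n ∈ toricLocalKer (W.baseChange K) (v.adicCompletion K) ((p ^ 1 : ℕ) : ℤ)) ∧
        -- transverse_on
        (∀ n : Finset (AdmQ W K p), n.Nonempty → Even n.card →
          ∀ m : Finset {ℓ // Zhang2014.IsKolyvaginPrime (W.conductorNorm ℤ) W K p ℓ}, ∀ ℓ ∈ m,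
          ∀ v : HeightOneSpectrum (𝓞 K), ((ℓ : ℕ) : 𝓞 K) ∈ v.asIdeal → κ₀ m n ∈ transverseLocalKerP W K p ι ℓ v) ∧
        -- relation (8.1)
        (∀ n : Finset (AdmQ W K p), n.Nonempty → Even n.card →
          ∀ (m : Finset {ℓ // Zhang2014.IsKolyvaginPrime (W.conductorNorm ℤ) W K p ℓ})
            (ℓ : {ℓ // Zhang2014.IsKolyvaginPrime (W.conductorNorm ℤ) W K p ℓ}), ℓ ∉ m →
          ∀ v : HeightOneSpectrum (𝓞 K), ((ℓ : ℕ) : 𝓞 K) ∈ v.asIdeal →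
          (κ₀ (insert ℓ m) n ∈ (W.baseChange K).torsionLocalKer (v.adicCompletion K) ((p ^ 1 : ℕ) : ℤ) ↔
            κ₀ m n ∈ (W.baseChange K).torsionLocalKer (v.adicCompletion K) ((p ^ 1 : ℕ) : ℤ))) ∧
        -- (A⇐) finite part at a NEW admissible prime ⟸ the value one level up
        (∀ (n : Finset (AdmQ W K p)) (q : AdmQ W K p), Even n.card → q ∉ n →
          ∀ m : Finset {ℓ // Zhang2014.IsKolyvaginPrime (W.conductorNorm ℤ) W K p ℓ},
          lam m (insert q n) ≠ 0 → ∃ v : HeightOneSpectrum (𝓞 K), ((q : ℕ) : 𝓞 K) ∈ v.asIdeal ∧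
            κ₀ m n ∉ (W.baseChange K).torsionLocalKer (v.adicCompletion K) ((p ^ 1 : ℕ) : ℤ)) ∧
        -- (B⇒) toric part at a LEVEL prime ⟹ the value one level down
        (∀ (n : Finset (AdmQ W K p)) (q : AdmQ W K p), Odd n.card → q ∉ n →
          ∀ (m : Finset {ℓ // Zhang2014.IsKolyvaginPrime (W.conductorNorm ℤ) W K p ℓ}) (v : HeightOneSpectrum (𝓞 K)),
          ((q : ℕ) : 𝓞 K) ∈ v.asIdeal →
          κ₀ m (insert q n) ∉ (W.baseChange K).torsionLocalKer (v.adicCompletion K) ((p ^ 1 : ℕ) : ℤ) →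
          lam m n ≠ 0) ∧
        -- (γ) the rank-0 anchor at the ODD levels
        (∀ n : Finset (AdmQ W K p), Odd n.card →
          finrank (ZMod p) (SelQP W K p c n true) + finrank (ZMod p) (SelQP W K p c n false) = 0 → lam ∅ n ≠ 0)) :
    LevelKolyvaginSystemsAdditive := by
  intro W _ _ _ p _ K _ _ Dt β ι h5 hadd hsurj hsp htwo htam hr hK hodd hlt hH hL hβ hcM c hc1 _
  obtain ⟨ε₀, κ₀, lam, hreal, hsign, hoff, hinf, htor, htr, hrel, hA, hB, hγ⟩ :=
    H W p K Dt β ι h5 hadd hsurj hsp htwo htam hr hK hodd hlt hH hL hβ hcM c hc1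
  exact nonempty_levelKolyvaginSystemP_of_bipartite_at_frame W K p c Dt β ι h5 hadd hsurj hsp htwo htam hr hK hodd hH hL
    hβ hcM hc1 ε₀ κ₀ lam hreal hsign hoff hinf htor htr hrel hA hB hγ

end Summit.BirchSwinnertonDyer.BirchSwinnertonDyer.Theorems.AdditiveKoly

end
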